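import Summits.BirchSwinnertonDyer.BirchSwinnertonDyer.Theorems.CongruentShaFreeCutBDPTripleCensus
import Summits.BirchSwinnertonDyer.BirchSwinnertonDyer.Theorems.CongruentShaFreeCutTwoAdicBDPTripleUpTo

set_option linter.dupNamespace false
set_option autoImplicit false

/-! # Route `CongruentShaFreeCut` (rung S2) — the corank-currency plumbing and crux A
# (`RankPosOfTwoSelmerCorankOne`, stmt-BirchSwinnertonDyer-19079, the route's residual) over the BDP triple
# UP TO NONZERO CONSTANTS (sibling of `CongruentShaFreeCutTwoAdicBDPTripleUpTo.lean`; ports of p440764)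

Cell `bsd-cn100`, prover seat `bsd-cn100-s2-c3` (g6), executing the plan seat's decision (iii) (plan g13, STATUS
2026-08-26T13:33:52Z), kernel follow-up (1) second half. Supports, does not close, stmt-BirchSwinnertonDyer-19079
(filed `--supports … --as helper`). THEOREMS ONLY — no definition, no named fact, nothing asserted. HONEST
FRAMING: CONDITIONAL reductions; nothing here proves crux A, crux B, the leaf, the congruent number problem or any
case of BSD. PARTITION: none — RANK axis.

The three ♯ statements `CongruentShaFreeCutTwoAdicBDPTripleUpTo.{TwoAdicBDPElementExistsUpTo,
TwoAdicWanDivisibilityUpTo, TwoAdicBDPValueAtOneUpTo}` (the BDP triple with Castella's display relaxed to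
`IsBDPLFunctionUpTo C`, `C ≠ 0`) enter by name; (res) at `2` enters as the hypothesis `hres` spelled EXACTLY as
the registered `stub_twoLocNonDegeneracy`; Link A in corank form is `TwoAdicControlOfCorankOne` /
`twoAdicControlOfCorankOne_of_res` (p438194).

* `heegnerPoint_not_isOfFinAddOrder_of_corankLinkA_of_bdpTripleUpTo` — corank-currency plumbing at `p = 2`
  over the ♯ triple (port of `CongruentShaFreeCutBDPTripleCensus.heegnerPoint_not_isOfFinAddOrder_of_corankLinkA_of_bdpTriple`;
  the value step reads constant terms directly: `u ∈ ℂ₂` is not a unit of `R₀`, so b2b's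
  `X11b.Halves.two_mul_sub_one_le_valuation` is not invoked);
* `rankPos_squarefree_of_corankLinkA_of_bdpTripleUpTo`, `cruxA_of_res_of_bdpTripleUpTo_of_poitouTate` — crux A
  on square-free `n` / BY NAME from (res) + the ♯ triple + Poitou–Tate + five refereed facts (ports).

References: [Castella2018] Thm. 2.3, 3.4; [CastellaGrossiLeeSkinner2022] §5.2; [Skinner2020] Thm. B (shape);
[SilvermanAEC2009] IV.6.4, VII.2.2. -/

noncomputable section

open scoped Classical

namespace Summit.BirchSwinnertonDyer.BirchSwinnertonDyer.Theorems.CongruentShaFreeCutBDPTripleUpToCensus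

open PowerSeries WeierstrassCurve NumberField IsDedekindDomain Field Literature.NumberTheory.EllipticCurves
  Literature.NumberTheory.EllipticCurves.ModularForms Literature.NumberTheory.QuadraticFields
  Literature.NumberTheory.EllipticCurves.Castella2018
open Literature.NumberTheory.GaloisRepresentations Literature.NumberTheory.GaloisCohomology
open Summit.BirchSwinnertonDyer.BirchSwinnertonDyer.Theses.CongruentShaFreeCut
open Summit.BirchSwinnertonDyer.BirchSwinnertonDyer.Theorems.CongruentShaFreeCutTwoAdicLinks
open Summit.BirchSwinnertonDyer.BirchSwinnertonDyer.Theorems.CongruentShaFreeCutTwoAdicBDPTripleUpTo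
  (TwoAdicBDPElementExistsUpTo TwoAdicWanDivisibilityUpTo TwoAdicBDPValueAtOneUpTo)
open Summit.BirchSwinnertonDyer.BirchSwinnertonDyer.Theorems.CongruentShaFreeCutTwoAdicLinksCorank
  (TwoAdicControlOfCorankOne heegnerPointSupply_of_gross)
open Summit.BirchSwinnertonDyer.BirchSwinnertonDyer.Theorems.CongruentShaFreeCutResidualCensus
  (twoAdicControlOfCorankOne_of_res)

/-! ## §1 Corank-currency plumbing over the ♯ triple -/

/-- **Link A in CORANK form + the ♯ triple force every Heegner point on `E_n` to be non-torsion at a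
corank-one datum** (port of p440764 `heegnerPoint_not_isOfFinAddOrder_of_corankLinkA_of_bdpTriple`; no Kato,
no rank hypothesis): for square-free `n`, `K` imaginary quadratic with the Heegner hypothesis for `N = N(E_n)`
and for `2`, `corank_{ℤ₂} Sel_{2^∞}(E_n/K) = 1`, and a Heegner point `P` of level `N`: `F(0) ≠ 0` (`hAc` at
THE embedding `embAt` of a degree-one `v ∣ 2`) ⟹ `𝓛(0) ≠ 0` ((LB-exist♯), (LB-wan♯) along `toUnr 2`:
`G · 𝓛 = 2^k · toUnr_* F` in the domain `R₀`) ⟹ `log_ω(τ_* P) ≠ 0` ((LB-bdp♯) at the Galois-conjugate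
reading: `𝓛(0) = u·c⁻²·(…)²·(log_ω P')²`) ⟹ `P` not torsion. The value step reads constant terms directly
(the ♯ unit `u ∈ ℂ₂` is not a unit of `R₀`, so b2b's `X11b.Halves.two_mul_sub_one_le_valuation` is not
invoked). CONDITIONAL; credits nothing.
[cite: Castella2018, proof of Thm. 2.3 with Thm. 3.4 (arXiv:1704.06608 pp. 5, 10) (shape)]
[cite: CastellaGrossiLeeSkinner2022, §5.2 (proof of Thm. 5.2.1)] [cite: SilvermanAEC2009, IV.6.4 and VII.2.2] -/
theorem heegnerPoint_not_isOfFinAddOrder_of_corankLinkA_of_bdpTripleUpTo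
    (hAc : TwoAdicControlOfCorankOne) (hE : TwoAdicBDPElementExistsUpTo)
    (hWan : TwoAdicWanDivisibilityUpTo) (hV : TwoAdicBDPValueAtOneUpTo) :
    ∀ ⦃n : ℕ⦄, Squarefree n → ∀ (K : Type) [Field K] [NumberField K] (N : ℕ) [NeZero N],
      (congruentNumberCurve n).conductorNorm ℤ = N → IsImaginaryQuadratic K →
        SatisfiesHeegnerHypothesis N K → SatisfiesHeegnerHypothesis 2 K →
          ((congruentNumberCurve n).baseChange K).selmerCorank 2 = 1 →
            ∀ (P : ((congruentNumberCurve n).baseChange K).toAffine.Point),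
              IsHeegnerPoint N (congruentNumberCurve n) K P → ¬ IsOfFinAddOrder P := by
  intro n hsq K _ _ N _ hN hK hHN hH2 hcK P hP hPtor
  haveI : Fact (Nat.Prime 2) := ⟨Nat.prime_two⟩
  haveI := isElliptic_congruentNumberCurve hsq.ne_zero
  haveI := isGloballyMinimal_congruentNumberCurve hsq
  have hsplit : ((Ideal.span {(2 : ℤ)}).primesOver (𝓞 K)).ncard = 2 :=
    hH2 2 Nat.prime_two (dvd_refl 2)
  -- (1) the anticyclotomic datum, THE embedding at a degree-one `v ∣ 2`, the partner `v̄`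
  obtain ⟨κ, γ, v, hκ, hγ, hv2, he, hf⟩ :=
    Summit.BirchSwinnertonDyer.Rank1Residual.X11b.exists_anticyclotomic_generator_degreeOnePrime 2 K hK hH2
  haveI : Fact (κ.IsTopGenerator γ) := ⟨hγ⟩
  set ι : K →+* ℚ_[2] := Summit.BirchSwinnertonDyer.Rank1Residual.X11b.embAt K 2 v hv2 he hf with hιdef
  have hv : ∀ x : 𝓞 K, x ∈ v.asIdeal ↔ ‖ι (x : K)‖ < 1 :=
    Summit.BirchSwinnertonDyer.Rank1Residual.X11b.mem_asIdeal_iff_norm_embAt_lt_one v hv2 he hf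
  obtain ⟨vbar, hvbar, hne⟩ :=
    Summit.BirchSwinnertonDyer.Rank1Residual.X11b.exists_other_prime hH2 v hv2
  -- (2) Link A (corank form): a generator `F` of `char_Λ 𝔛` with `F(0) ≠ 0`
  obtain ⟨m, hm⟩ := hAc hsq K N hN hK hHN hH2 ι v vbar hv hvbar hne κ hκ γ hcK
  obtain ⟨-, F, hF, hF0, -⟩ := hm
  have hFmem : F ∈ AcSelmer.XAc.charIdeal ((congruentNumberCurve n).baseChange K) 2 κ vbar ∅ γ := by
    rw [hF]; exact Ideal.mem_span_singleton_self F
  -- (3) the Heegner point data; its Galois conjugate readable at an infinite place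
  obtain ⟨Dt, H, ιK, hPK⟩ := hP
  obtain ⟨w₀⟩ := (inferInstance : Nonempty (InfinitePlace K))
  haveI : IsGalois ℚ K := by
    haveI : Algebra.IsQuadraticExtension ℚ K := ⟨hK.1⟩
    infer_instance
  obtain ⟨σ, hσ⟩ := NumberField.ComplexEmbedding.exists_comp_symm_eq_of_comp_eq (k := ℚ)
    w₀.embedding ιK (by ext x; simp)
  set τ : K →+* K := ((σ.symm : K ≃ₐ[ℚ] K) : K →+* K) with hτdef
  set P' := WeierstrassCurve.Affine.Point.map τ.toRatAlgHom P with hP'def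
  have hP' : WeierstrassCurve.Affine.Point.map w₀.embedding.toRatAlgHom P' =
      heegnerPointComplex Dt H := by
    rw [hP'def, WeierstrassCurve.Affine.Point.map_map]
    have hcomp : w₀.embedding.toRatAlgHom.comp τ.toRatAlgHom = ιK.toRatAlgHom := by
      apply AlgHom.ext
      intro x
      have := RingHom.congr_fun hσ x
      simpa [hτdef] using this
    rw [hcomp]
    exact hPK
  have hP'tor : IsOfFinAddOrder P' := by
    rw [hP'def]; exact AddMonoidHom.isOfFinAddOrder _ hPtor
  -- (4) the BDP element up to `C ≠ 0` and its embedding datum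
  obtain ⟨ι', hι', ΩK, Ωp, Cst, L, hΩK, hC, hBDP⟩ := hE hsq K N Dt v κ γ hN hK hHN hsplit hv2 hκ
  -- (5) (LB-wan♯) along `toUnr : ℤ₂ → R₀`: `𝓛(0) ≠ 0`
  obtain ⟨k, hk⟩ := hWan hsq ι' K N Dt v vbar κ γ hN hK hHN hsplit hι' hvbar hne hκ ΩK Ωp Cst L hΩK
    hC hBDP (Summit.BirchSwinnertonDyer.Rank1Residual.X11b.Halves.toUnr 2)
    (Summit.BirchSwinnertonDyer.Rank1Residual.X11b.Halves.coe_toUnr 2)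
  obtain ⟨G, hG⟩ := Ideal.mem_span_singleton'.mp (hk F hFmem)
  have hL0 : PowerSeries.constantCoeff L ≠ 0 := by
    intro h0
    have h1 := congrArg (fun S : UnrSeries 2 ↦ ((PowerSeries.constantCoeff S : unrIntegers 2) : ℂ_[2])) hG
    simp only [map_mul, h0, mul_zero, PowerSeries.constantCoeff_C,
      Summit.BirchSwinnertonDyer.Rank1Residual.X11b.CongruenceLimit.constantCoeff_map_apply, Subring.coe_mul, Subring.coe_pow, Subring.coe_zero,
      Summit.BirchSwinnertonDyer.Rank1Residual.X11b.Halves.coe_toUnr] at h1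
    have h2 : ((2 : unrIntegers 2) : ℂ_[2]) = (2 : ℂ_[2]) := by norm_cast
    rw [h2] at h1
    have h3 : algebraMap ℚ_[2] ℂ_[2] ((PowerSeries.constantCoeff F : ℤ_[2]) : ℚ_[2]) = 0 := by
      rcases mul_eq_zero.mp h1.symm with h | h
      · exact absurd (pow_eq_zero_iff'.mp h).1 two_ne_zero
      · exact h
    rw [map_eq_zero_iff _ (algebraMap ℚ_[2] ℂ_[2]).injective] at h3
    exact hF0 (PadicInt.coe_eq_zero.mp h3)
  -- (6) (LB-bdp♯) at the conjugate reading `P'`: `𝓛(0) = u·c⁻²·(…)²·(log_ω P')²`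
  obtain ⟨u, -, hu⟩ := hV hsq ι' K N Dt H w₀ ι v κ γ P' hN hK hHN hsplit hv2 hι' hκ hP' hv ΩK Ωp Cst L
    hΩK hC hBDP
  have hval := UnrSeries.eq_constantCoeff_of_hasValueAt_zero hu
  -- (7) a torsion `P'` has zero logarithm, so `𝓛(0) = 0`: contradiction
  have hlog : padicLogOmega (congruentNumberCurve n) 2 ι P' = 0 := by
    unfold padicLogOmega
    rw [AcPConverseLinks.padicLogPoint_formalIndex_smul_eq_zero_of_isOfFinAddOrder
      (congruentNumberCurve n) 2 ι hP'tor, zero_div]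
  apply hL0
  rw [hlog, zero_pow two_ne_zero, mul_zero, map_zero, mul_zero] at hval
  exact_mod_cast hval.symm

/-- **Crux A on square-free `n` from Link A in corank form and the ♯ triple** (port of p440764
`rankPos_squarefree_of_corankLinkA_of_bdpTriple`; five refereed facts for the descent field and the Heegner
point): descend to the Heegner field (`CongruentShaFreeCutDescentField.descentField_of_parity_of_hoffsteinLuo_of_kato`),
take a Heegner point (`heegnerPointSupply_of_gross`), apply the ♯ corank-currency plumbing, Mordell–Weil.
CONDITIONAL; credits nothing. [cite: CastellaGrossiLeeSkinner2022, §5.2 (proof of Thm. 5.2.1)] -/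
theorem rankPos_squarefree_of_corankLinkA_of_bdpTripleUpTo
    (hpar : ∀ (W : WeierstrassCurve ℚ) [W.IsElliptic] (p : ℕ) [Fact p.Prime], p_parity W p)
    (hmod : ModularForms.exists_isNewformOf) (hHL : HoffsteinLuo1997_exists_twist_L_one_ne_zero)
    (hKato : ∀ (W : WeierstrassCurve ℚ) [W.IsElliptic] (p : ℕ) [Fact p.Prime],
      kato_finite_of_L_one_ne_zero W p)
    (hHP : ∀ (W : WeierstrassCurve ℚ) (K : Type) [Field K] [NumberField K],
      exists_isHeegnerPoint W K)
    (hAc : TwoAdicControlOfCorankOne) (hE : TwoAdicBDPElementExistsUpTo)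
    (hWan : TwoAdicWanDivisibilityUpTo) (hV : TwoAdicBDPValueAtOneUpTo) :
    ∀ ⦃n : ℕ⦄, Squarefree n → (congruentNumberCurve n).selmerCorank 2 = 1 →
      1 ≤ (congruentNumberCurve n).mordellWeilRank := by
  intro n hsq hc
  haveI := isElliptic_congruentNumberCurve hsq.ne_zero
  haveI := isGloballyMinimal_congruentNumberCurve hsq
  haveI : NeZero ((congruentNumberCurve n).conductorNorm ℤ) :=
    ⟨((congruentNumberCurve n).conductorNorm_pos_holds).ne'⟩
  obtain ⟨K, _, _, hK, hHN, hH2, hcK, hrk⟩ :=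
    CongruentShaFreeCutDescentField.descentField_of_parity_of_hoffsteinLuo_of_kato hpar hmod hHL hKato
      hsq.ne_zero hc
  obtain ⟨P, hP⟩ :=
    heegnerPointSupply_of_gross hHP hsq K ((congruentNumberCurve n).conductorNorm ℤ) rfl hK hHN
  have hPnt : ¬ IsOfFinAddOrder P :=
    heegnerPoint_not_isOfFinAddOrder_of_corankLinkA_of_bdpTripleUpTo hAc hE hWan hV hsq K
      ((congruentNumberCurve n).conductorNorm ℤ) rfl hK hHN hH2 hcK P hP
  have hrkK : 1 ≤ ((congruentNumberCurve n).baseChange K).mordellWeilRank :=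
    one_le_mordellWeilRank_of_not_isOfFinAddOrder _
      ((congruentNumberCurve n).baseChange K).module_finite_point_holds hPnt
  rwa [hrk] at hrkK

/-- **Crux A `RankPosOfTwoSelmerCorankOne` (stmt-19079, the route's residual) from (res) at `2`, the ♯
triple, Poitou–Tate and five refereed facts** (port of p440764 `cruxA_of_res_of_bdpTriple_of_poitouTate`):
Link A in corank form is `twoAdicControlOfCorankOne_of_res hPT hres` (p438194), then
`rankPos_squarefree_of_corankLinkA_of_bdpTripleUpTo` and the square-free reduction
`rankPosOfTwoSelmerCorankOne_of_squarefree` (p419178). CONDITIONAL; credits nothing.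
[cite: Skinner2020, Thm. B (shape)] [cite: CastellaGrossiLeeSkinner2022, §5.2 (proof of Thm. 5.2.1)] -/
theorem cruxA_of_res_of_bdpTripleUpTo_of_poitouTate
    (hpar : ∀ (W : WeierstrassCurve ℚ) [W.IsElliptic] (p : ℕ) [Fact p.Prime], p_parity W p)
    (hmod : ModularForms.exists_isNewformOf) (hHL : HoffsteinLuo1997_exists_twist_L_one_ne_zero)
    (hKato : ∀ (W : WeierstrassCurve ℚ) [W.IsElliptic] (p : ℕ) [Fact p.Prime],
      kato_finite_of_L_one_ne_zero W p)
    (hHP : ∀ (W : WeierstrassCurve ℚ) (K : Type) [Field K] [NumberField K],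
      exists_isHeegnerPoint W K)
    (hPT : ∀ (K : Type) [Field K] [NumberField K], poitouTate_sum_localTatePairing_eq_zero K)
    (hres : ∀ ⦃n : ℕ⦄, Squarefree n → ∀ (K : Type) [Field K] [NumberField K],
      IsImaginaryQuadratic K → SatisfiesHeegnerHypothesis 2 K →
        ((congruentNumberCurve n).baseChange K).selmerCorank 2 = 1 →
      ∀ (w : HeightOneSpectrum (𝓞 K)), ((2 : ℕ) : 𝓞 K) ∈ w.asIdeal →
        Finite ↥(((congruentNumberCurve n).baseChange K).selmerGroupPInfty 2 ⊓
          selmerLocalKerPrimaryTorsion ((congruentNumberCurve n).baseChange K) (w.adicCompletion K) 2))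
    (hE : TwoAdicBDPElementExistsUpTo) (hWan : TwoAdicWanDivisibilityUpTo)
    (hV : TwoAdicBDPValueAtOneUpTo) : RankPosOfTwoSelmerCorankOne :=
  CongruentShaFreeCutRankPosSquarefreeReduction.rankPosOfTwoSelmerCorankOne_of_squarefree
    (rankPos_squarefree_of_corankLinkA_of_bdpTripleUpTo hpar hmod hHL hKato hHP
      (twoAdicControlOfCorankOne_of_res hPT hres) hE hWan hV)

end Summit.BirchSwinnertonDyer.BirchSwinnertonDyer.Theorems.CongruentShaFreeCutBDPTripleUpToCensus

end
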